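import Summits.BirchSwinnertonDyer.BirchSwinnertonDyer.Theorems.ByReductionTypeAtTwoMultUpperHalfTowerAcur
import Summits.BirchSwinnertonDyer.BirchSwinnertonDyer.Theorems.ByReductionTypeAtTwoTowerClassKitC
import HarnessLib

/-!
# Route `ByReductionTypeAtTwo`, item `MultUpperHalfAtTwo` (stmt-BirchSwinnertonDyer-19922): the multiplicative TOWER road in the
# A-currency, TWO-LAYER form — `MissingUpperBoundAt W 2` / `BSDp W 2` at a rank-0, `E[2]`-irreducible, multiplicative-at-2 curve
# from the PLAIN classical layer count `2^a ≤ #Sel_{2^∞}(E/ℚ_j)[2]` at a layer `j` and ONE count of the RELAXED layer group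
# `#A_{j'}[2] ≤ 2^d` at a layer `j' ≥ j` — NO σ-pieces, NO local interface, NO local constant
# (seat bsd-2adic-tower-1 GEN 15; home item stmt-BirchSwinnertonDyer-19271)

HONEST FRAMING (cell `bsd-2adic`, run/shared/lean/pub/bsd-2adic/, HUMAN RULINGS D-0036/D-0054/D-0074): door THEOREMS only;
no definition, no new named fact, no `sorry`; they close no item by themselves; nothing is booked; BSD is not proved by any
of this. PARTITION: X5@2 multiplicative TOWER rows (K4ᵐ, item 19922; the `E[2]`-irreducible block — the 190 of the 220
HYBRID-certified classes of `tower/TABLE-MULT-TOWER-ACUR-HYBRID-gen14.tsv` whose column `twolayer_window` is non-empty) × p = 2 —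
types-the-object-of (the W-level composition the class files instantiate in five lines per member); closes none.

WHAT. Ord-2's two-layer gap door in the exact currency with a STRICT lower count,
`TowerClass.towerGapAtTwo_of_layerSelmer_of_layerClasses_counts` (`…TowerClassKitC`: odd torsion order, `j ≤ j'`,
`2^a ≤ #Sel_{2^∞}(E/ℚ_j)[2]` — free lower bound for `#X/(2,T^{2^j})X` by `Sel_j ≤ A_j` and tower-1 part 2
`TowerLayer.natCard_quotient_towerIdeal_eq_natCard_layerClasses` —, `#A_{j'}[2] ≤ 2^d` — EXACTLY `#X/(2,T^{2^{j'}})X` —,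
`d + 1 ≤ 2^{j'} − 2^j + a` ⟹ `O1.TowerGapAtTwo W`), composed with the mult lane's class door
`missingUpperBoundAt_two_mult_of_towerGapMember'` (`…MultUpperHalfTower`) exactly as GEN 13's σ-window compositions
(`…MultUpperHalfTowerAcur`, p572550): for `W/ℚ` globally minimal, analytic rank `0`, multiplicative at `2`, `Irr W 2`:
* `MultTowerAcur.missingUpperBoundAt_two_of_twoLayer_classCounts_upper` — HYBRID two-layer certificate: `hlow` = the plain
  classical layer count `2^a ≤ #Sel_{2^∞}(E/ℚ_j)[2]` (the lane's booked `d_j` currency — ENGINE A ∥ ENGINE B3/B2 two-layer, no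
  σ-vector needed), `hup` = `#A_{j'}[2] ≤ 2^d` (the induced count at layer `j'`; at a multiplicative `2` read by the B1-MULT rule,
  `tower/NOTE-B1-MULT-GEN13.md`, CERT-TOWER-E1-ADDENDUM-6), `had : d + 1 ≤ 2^{j'} − 2^j + a` ⟹ `MissingUpperBoundAt W 2`;
  `…bsdp_two_…` adds `hsha : MissingLowerBoundAt W 2` ⟹ `BSDp W 2`;
* `MultTowerAcur.missingUpperBoundAt_two_of_twoLayer_classCounts` — both counts in the A-currency (`2^a ≤ #A_j[2]`);
* `…_member` forms — the certificate carried by an isogenous `E[2]`-irreducible member `W₁ ~_ℚ W`.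
It is the σ-window door of p572550 at the window `(m, k) = (2^j, 2^{j'} − 2^j)` with the lower σ-piece of layer `j'` REPLACED by
the layer-`j` Selmer count (`#Sel_{2^∞}(E/ℚ_j)[2] ≤ #X/(2,T^{2^j})X` directly, no inflation–restriction needed): for the desk this
removes the σ-vector from the lower leg of every two-layer-certifiable row. DISPLAYED, NOT PROVED: PRINT {`h41ns'`, `h41sp`, `hmod`,
`hGZK`, `hCassels`, `hC`} + MEMO {`hKato` K11a (RC-2), `hGS` (RC-4, idle at a non-split 2)} — VERBATIM the binders of every mult
tower class file of record — + CERTIFICATES {`hr`, `hlow`, `hup`, `had`, (`hsha`)}.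

References: R. Greenberg, LNM 1716 (1999) §1 p. 60, §2 pp. 74–76, §3 pp. 85–94, §4 pp. 112–113; L. Washington, *Introduction
to Cyclotomic Fields* §13.2; K. Česnavičius, Duke Math. J. 167 (2018) Thm. 1.2; R. L. Miller, LMS J. Comput. Math. 14 (2011)
Def. 1.1; the docstrings of the two imported files.
-/

set_option autoImplicit false
-- the Theorems namespace of this sub repeats the summit name by design (D-0017 nested layout: Summit.<S>.<Sub>)
set_option linter.dupNamespace false

noncomputable section

open scoped Classical MatrixGroups ModularForm

open NumberField IsDedekindDomain CongruenceSubgroup WeierstrassCurve Literature.NumberTheory.EllipticCurves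
  Literature.NumberTheory.EllipticCurves.ModularForms Literature.NumberTheory.EllipticCurves.Rank1Residual
  Literature.NumberTheory.EllipticCurves.Rank1Residual.Typed
  Literature.NumberTheory.EllipticCurves.Greenberg1999
  Summit.BirchSwinnertonDyer.Rank1Residual.X5 Summit.BirchSwinnertonDyer.Rank1Residual.X5.O1
  Summit.BirchSwinnertonDyer.BirchSwinnertonDyer.Theorems.KatoHalfPinch
  Summit.BirchSwinnertonDyer.BirchSwinnertonDyer.Theorems.Rank1ResidualX1Defs

namespace Summit.BirchSwinnertonDyer.BirchSwinnertonDyer.Theorems.MultTowerAcur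

section Curve

variable (W : WeierstrassCurve ℚ) [W.IsElliptic] [W.IsGloballyMinimal]

/-- **Two-layer A-currency gap at an `E[2]`-irreducible curve, HYBRID counts** (odd torsion from `Irr W 2`): `j ≤ j'`,
`2^a ≤ #Sel_{2^∞}(E/ℚ_j)[2]`, `#A_{j'}[2] ≤ 2^d`, `d + 1 ≤ 2^{j'} − 2^j + a` ⟹ `O1.TowerGapAtTwo W`
(`TowerClass.towerGapAtTwo_of_layerSelmer_of_layerClasses_counts`).
[cite: GreenbergLNM1716, §1 p. 60 and §3 pp. 85–86] [cite: Washington1997, §13.2] -/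
theorem towerGapAtTwo_of_twoLayer_classCounts_upper_of_irr (hirr : Irr W 2) {j j' a d : ℕ} (hjj' : j ≤ j')
    (hlow : ∀ κ : ZpExtension ℚ 2, κ.IsCyclotomic → 2 ^ a ≤ Nat.card {z : W.selmerLayer κ j // 2 • z = 0})
    (hup : ∀ κ : ZpExtension ℚ 2, κ.IsCyclotomic →
      Nat.card {z : W.selmerInftyPreimage κ j' // 2 • z = 0} ≤ 2 ^ d)
    (had : d + 1 ≤ 2 ^ j' - 2 ^ j + a) : TowerGapAtTwo W :=
  TowerClass.towerGapAtTwo_of_layerSelmer_of_layerClasses_counts W (not_two_dvd_torsionOrder_of_irr_two W hirr)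
    hjj' hlow hup had

/-- **Two-layer A-currency gap at an `E[2]`-irreducible curve, BOTH counts induced**: `j ≤ j'`, `2^a ≤ #A_j[2]`,
`#A_{j'}[2] ≤ 2^d`, `d + 1 ≤ 2^{j'} − 2^j + a` ⟹ `O1.TowerGapAtTwo W` (`TowerClass.towerGapAtTwo_of_layerClasses_counts`).
[cite: GreenbergLNM1716, §1 p. 60 and §3 pp. 85–86] [cite: Washington1997, §13.2] -/
theorem towerGapAtTwo_of_twoLayer_classCounts_of_irr (hirr : Irr W 2) {j j' a d : ℕ} (hjj' : j ≤ j')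
    (hlow : ∀ κ : ZpExtension ℚ 2, κ.IsCyclotomic →
      2 ^ a ≤ Nat.card {z : W.selmerInftyPreimage κ j // 2 • z = 0})
    (hup : ∀ κ : ZpExtension ℚ 2, κ.IsCyclotomic →
      Nat.card {z : W.selmerInftyPreimage κ j' // 2 • z = 0} ≤ 2 ^ d)
    (had : d + 1 ≤ 2 ^ j' - 2 ^ j + a) : TowerGapAtTwo W :=
  TowerClass.towerGapAtTwo_of_layerClasses_counts W (not_two_dvd_torsionOrder_of_irr_two W hirr) hjj' hlow hup had

/-- **UPPER HALF at a rank-0, multiplicative-at-2, `E[2]`-irreducible `W` from the TWO-LAYER A-currency certificate, HYBRID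
counts.** PRINT {`h41ns'`, `h41sp`, `hmod`, `hGZK`, `hCassels`, `hC`} + MEMO {`hKato` (RC-2), `hGS` (RC-4)} + CERTIFICATES {`hr`,
`hlow : 2^a ≤ #Sel_{2^∞}(E/ℚ_j)[2]` (classical layer count), `hup : #A_{j'}[2] ≤ 2^d` (induced layer count),
`had : d + 1 ≤ 2^{j'} − 2^j + a`}; NO σ-pieces, NO odd-prime data, NO local constant.
[cite: GreenbergLNM1716, §3 pp. 85–94 and §4 pp. 112–113] [cite: Cesnavicius2018, Thm. 1.2] [cite: Miller2011LMS, Def. 1.1] -/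
theorem missingUpperBoundAt_two_of_twoLayer_classCounts_upper
    (hKato : ∀ (W : WeierstrassCurve ℚ) [W.IsElliptic] [W.IsGloballyMinimal],
      ¬ W.HasCM → Mult W 2 → O1.KatoMultiplicativeDivisibilityRat W 2)
    (h41ns' : thm41Analogue_charValue_rankZero_numberField_anyPrime_oddLocalDegree)
    (h41sp : thm41Analogue_charValue_rankZero_split_baseChange_anyPrime)
    (hmod : nonempty_modularParametrizationData)
    (hGZK : rank_eq_analyticRank_of_analyticRank_le_one)
    (hCassels : bsdRHS_eq_of_isIsogenous)
    (hC : cesnavicius_not_two_dvd_maninConstant_of_two_dvd_level)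
    (hGS : ∀ (W : WeierstrassCurve ℚ) [W.IsElliptic] [W.IsGloballyMinimal],
      W.HasSplitMultiplicativeReductionAtPrime 2 → greenberg_stevens (W := W) (p := 2))
    (hr : W.analyticRank = 0) (hmult : Mult W 2) (hirr : Irr W 2) {j j' a d : ℕ} (hjj' : j ≤ j')
    (hlow : ∀ κ : ZpExtension ℚ 2, κ.IsCyclotomic → 2 ^ a ≤ Nat.card {z : W.selmerLayer κ j // 2 • z = 0})
    (hup : ∀ κ : ZpExtension ℚ 2, κ.IsCyclotomic →
      Nat.card {z : W.selmerInftyPreimage κ j' // 2 • z = 0} ≤ 2 ^ d)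
    (had : d + 1 ≤ 2 ^ j' - 2 ^ j + a) : MissingUpperBoundAt W 2 :=
  missingUpperBoundAt_two_mult_of_towerGapMember' hKato h41ns' h41sp hmod hGZK hCassels hC hGS W hr hmult W
    (IsIsogenous.refl_holds W) (towerGapAtTwo_of_twoLayer_classCounts_upper_of_irr W hirr hjj' hlow hup had)
    (Or.inl hirr)

/-- **`BSDp W 2` at a rank-0, multiplicative-at-2, `E[2]`-irreducible `W` from the TWO-LAYER A-currency certificate (HYBRID
counts) + the descent inequality `hsha : MissingLowerBoundAt W 2`.** [cite: Miller2011LMS, Def. 1.1] [cite: GreenbergLNM1716, §3 pp. 85–94] -/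
theorem bsdp_two_of_twoLayer_classCounts_upper
    (hKato : ∀ (W : WeierstrassCurve ℚ) [W.IsElliptic] [W.IsGloballyMinimal],
      ¬ W.HasCM → Mult W 2 → O1.KatoMultiplicativeDivisibilityRat W 2)
    (h41ns' : thm41Analogue_charValue_rankZero_numberField_anyPrime_oddLocalDegree)
    (h41sp : thm41Analogue_charValue_rankZero_split_baseChange_anyPrime)
    (hmod : nonempty_modularParametrizationData)
    (hGZK : rank_eq_analyticRank_of_analyticRank_le_one)
    (hCassels : bsdRHS_eq_of_isIsogenous)
    (hC : cesnavicius_not_two_dvd_maninConstant_of_two_dvd_level)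
    (hGS : ∀ (W : WeierstrassCurve ℚ) [W.IsElliptic] [W.IsGloballyMinimal],
      W.HasSplitMultiplicativeReductionAtPrime 2 → greenberg_stevens (W := W) (p := 2))
    (hr : W.analyticRank = 0) (hmult : Mult W 2) (hirr : Irr W 2) {j j' a d : ℕ} (hjj' : j ≤ j')
    (hlow : ∀ κ : ZpExtension ℚ 2, κ.IsCyclotomic → 2 ^ a ≤ Nat.card {z : W.selmerLayer κ j // 2 • z = 0})
    (hup : ∀ κ : ZpExtension ℚ 2, κ.IsCyclotomic →
      Nat.card {z : W.selmerInftyPreimage κ j' // 2 • z = 0} ≤ 2 ^ d)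
    (had : d + 1 ≤ 2 ^ j' - 2 ^ j + a) (hsha : MissingLowerBoundAt W 2) : BSDp W 2 :=
  bsdp_of_missingPPartAt W 2 hGZK (hr.le.trans zero_le_one)
    (missingPPartAt_of_lower_of_upper W 2 hsha
      (missingUpperBoundAt_two_of_twoLayer_classCounts_upper W hKato h41ns' h41sp hmod hGZK hCassels hC hGS hr hmult
        hirr hjj' hlow hup had))

/-- **UPPER HALF, TWO-LAYER certificate with both counts induced** (`2^a ≤ #A_j[2]`, `#A_{j'}[2] ≤ 2^d`,
`d + 1 ≤ 2^{j'} − 2^j + a`). Same PRINT/MEMO display. [cite: GreenbergLNM1716, §3 pp. 85–94 and §4 pp. 112–113]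
[cite: Cesnavicius2018, Thm. 1.2] [cite: Miller2011LMS, Def. 1.1] -/
theorem missingUpperBoundAt_two_of_twoLayer_classCounts
    (hKato : ∀ (W : WeierstrassCurve ℚ) [W.IsElliptic] [W.IsGloballyMinimal],
      ¬ W.HasCM → Mult W 2 → O1.KatoMultiplicativeDivisibilityRat W 2)
    (h41ns' : thm41Analogue_charValue_rankZero_numberField_anyPrime_oddLocalDegree)
    (h41sp : thm41Analogue_charValue_rankZero_split_baseChange_anyPrime)
    (hmod : nonempty_modularParametrizationData)
    (hGZK : rank_eq_analyticRank_of_analyticRank_le_one)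
    (hCassels : bsdRHS_eq_of_isIsogenous)
    (hC : cesnavicius_not_two_dvd_maninConstant_of_two_dvd_level)
    (hGS : ∀ (W : WeierstrassCurve ℚ) [W.IsElliptic] [W.IsGloballyMinimal],
      W.HasSplitMultiplicativeReductionAtPrime 2 → greenberg_stevens (W := W) (p := 2))
    (hr : W.analyticRank = 0) (hmult : Mult W 2) (hirr : Irr W 2) {j j' a d : ℕ} (hjj' : j ≤ j')
    (hlow : ∀ κ : ZpExtension ℚ 2, κ.IsCyclotomic →
      2 ^ a ≤ Nat.card {z : W.selmerInftyPreimage κ j // 2 • z = 0})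
    (hup : ∀ κ : ZpExtension ℚ 2, κ.IsCyclotomic →
      Nat.card {z : W.selmerInftyPreimage κ j' // 2 • z = 0} ≤ 2 ^ d)
    (had : d + 1 ≤ 2 ^ j' - 2 ^ j + a) : MissingUpperBoundAt W 2 :=
  missingUpperBoundAt_two_mult_of_towerGapMember' hKato h41ns' h41sp hmod hGZK hCassels hC hGS W hr hmult W
    (IsIsogenous.refl_holds W) (towerGapAtTwo_of_twoLayer_classCounts_of_irr W hirr hjj' hlow hup had)
    (Or.inl hirr)

end Curve

/-! ## §2 The class form: the two-layer certificate carried by an isogenous `E[2]`-irreducible member -/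

section Member

/-- **UPPER HALF at every member `W` of the class of a certified member `W₁`** (`W₁ ~_ℚ W`, `Irr W₁ 2`, the TWO-LAYER
A-currency certificate at `W₁`, HYBRID counts). Same display; Cassels moves the half across the class inside
`missingUpperBoundAt_two_mult_of_towerGapMember'`. [cite: GreenbergLNM1716, §3 pp. 85–94 and §4 pp. 112–113]
[cite: Cesnavicius2018, Thm. 1.2] [cite: Cassels1965ArithmeticVIII] [cite: Miller2011LMS, Def. 1.1] -/
theorem missingUpperBoundAt_two_of_twoLayer_classCounts_upper_member
    (hKato : ∀ (W : WeierstrassCurve ℚ) [W.IsElliptic] [W.IsGloballyMinimal],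
      ¬ W.HasCM → Mult W 2 → O1.KatoMultiplicativeDivisibilityRat W 2)
    (h41ns' : thm41Analogue_charValue_rankZero_numberField_anyPrime_oddLocalDegree)
    (h41sp : thm41Analogue_charValue_rankZero_split_baseChange_anyPrime)
    (hmod : nonempty_modularParametrizationData)
    (hGZK : rank_eq_analyticRank_of_analyticRank_le_one)
    (hCassels : bsdRHS_eq_of_isIsogenous)
    (hC : cesnavicius_not_two_dvd_maninConstant_of_two_dvd_level)
    (hGS : ∀ (W : WeierstrassCurve ℚ) [W.IsElliptic] [W.IsGloballyMinimal],
      W.HasSplitMultiplicativeReductionAtPrime 2 → greenberg_stevens (W := W) (p := 2))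
    (W : WeierstrassCurve ℚ) [W.IsElliptic] [W.IsGloballyMinimal] (hr : W.analyticRank = 0) (hmult : Mult W 2)
    (W₁ : WeierstrassCurve ℚ) [W₁.IsElliptic] [W₁.IsGloballyMinimal] (hiso : IsIsogenous W W₁) (hirr₁ : Irr W₁ 2)
    {j j' a d : ℕ} (hjj' : j ≤ j')
    (hlow : ∀ κ : ZpExtension ℚ 2, κ.IsCyclotomic → 2 ^ a ≤ Nat.card {z : W₁.selmerLayer κ j // 2 • z = 0})
    (hup : ∀ κ : ZpExtension ℚ 2, κ.IsCyclotomic →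
      Nat.card {z : W₁.selmerInftyPreimage κ j' // 2 • z = 0} ≤ 2 ^ d)
    (had : d + 1 ≤ 2 ^ j' - 2 ^ j + a) : MissingUpperBoundAt W 2 :=
  missingUpperBoundAt_two_mult_of_towerGapMember' hKato h41ns' h41sp hmod hGZK hCassels hC hGS W hr hmult W₁ hiso
    (towerGapAtTwo_of_twoLayer_classCounts_upper_of_irr W₁ hirr₁ hjj' hlow hup had) (Or.inl hirr₁)

/-- **`BSDp W 2` at every member of the class of a certified member `W₁`** (TWO-LAYER HYBRID counts at `W₁`) +
`hsha : MissingLowerBoundAt W 2`. [cite: Miller2011LMS, Def. 1.1] [cite: Cassels1965ArithmeticVIII] -/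
theorem bsdp_two_of_twoLayer_classCounts_upper_member
    (hKato : ∀ (W : WeierstrassCurve ℚ) [W.IsElliptic] [W.IsGloballyMinimal],
      ¬ W.HasCM → Mult W 2 → O1.KatoMultiplicativeDivisibilityRat W 2)
    (h41ns' : thm41Analogue_charValue_rankZero_numberField_anyPrime_oddLocalDegree)
    (h41sp : thm41Analogue_charValue_rankZero_split_baseChange_anyPrime)
    (hmod : nonempty_modularParametrizationData)
    (hGZK : rank_eq_analyticRank_of_analyticRank_le_one)
    (hCassels : bsdRHS_eq_of_isIsogenous)
    (hC : cesnavicius_not_two_dvd_maninConstant_of_two_dvd_level)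
    (hGS : ∀ (W : WeierstrassCurve ℚ) [W.IsElliptic] [W.IsGloballyMinimal],
      W.HasSplitMultiplicativeReductionAtPrime 2 → greenberg_stevens (W := W) (p := 2))
    (W : WeierstrassCurve ℚ) [W.IsElliptic] [W.IsGloballyMinimal] (hr : W.analyticRank = 0) (hmult : Mult W 2)
    (W₁ : WeierstrassCurve ℚ) [W₁.IsElliptic] [W₁.IsGloballyMinimal] (hiso : IsIsogenous W W₁) (hirr₁ : Irr W₁ 2)
    {j j' a d : ℕ} (hjj' : j ≤ j')
    (hlow : ∀ κ : ZpExtension ℚ 2, κ.IsCyclotomic → 2 ^ a ≤ Nat.card {z : W₁.selmerLayer κ j // 2 • z = 0})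
    (hup : ∀ κ : ZpExtension ℚ 2, κ.IsCyclotomic →
      Nat.card {z : W₁.selmerInftyPreimage κ j' // 2 • z = 0} ≤ 2 ^ d)
    (had : d + 1 ≤ 2 ^ j' - 2 ^ j + a) (hsha : MissingLowerBoundAt W 2) : BSDp W 2 :=
  bsdp_of_missingPPartAt W 2 hGZK (hr.le.trans zero_le_one)
    (missingPPartAt_of_lower_of_upper W 2 hsha
      (missingUpperBoundAt_two_of_twoLayer_classCounts_upper_member hKato h41ns' h41sp hmod hGZK hCassels hC hGS
        W hr hmult W₁ hiso hirr₁ hjj' hlow hup had))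

end Member

end Summit.BirchSwinnertonDyer.BirchSwinnertonDyer.Theorems.MultTowerAcur

end
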